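import Summits.ResolutionOfSingularities.ResolutionOfSingularities.Theorems.EquisingularLiftEquisingularLiftNatMarkedTower
import Summits.ResolutionOfSingularities.ResolutionOfSingularities.Theorems.EquisingularLiftEquisingularLiftNatTwoStepVertexA3
import Summits.ResolutionOfSingularities.ResolutionOfSingularities.Theorems.EquisingularLiftEquisingularLiftNatAffineTwoStepPackage
import HarnessLib

/-!
# [OURS] THE FIRST DEPTH-2 CERTIFICATE: the `A₅` point `y₀y₁ + y₂⁶` has level `2` in EVERY blow-up tower (`A₅ → A₃ → A₁ → ∅` under point blow-ups),
# by one turn of the all-levels marked engine ✓ `OneStep.towerLevel_succ_origin_marked` on top of the level-1 certificate of the `A₃` specimen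
# (cruxes `Theses.EquisingularLift.EquisingularLiftNat` / `…NatThree` / `EquisingularLift`, stmt-ResolutionOfSingularities-20038 / -20148 / -15660)

[OURS · leafhand-res-equisingularlift-12 g0, 2026-08-31; cell `pub/decomp-res`] AI-produced, weaker than expert review; NOT a statement of any manuscript;
nothing here proves resolution of singularities in positive characteristic.  DEF-FREE helper; no `sorry`; standard axioms; ZERO named hypotheses.

* `SecondOrderPoint.A₅_strictTransform₂` — chart `2` of `f = y₀y₁ + y₂⁶`: `f(T₂T₀, T₂T₁, T₂) = T₂²·(T₀T₁ + T₂⁴)` — the `A₃` specimen at the chart origin;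
* `SecondOrderPoint.A₃_specimen_twoStepData` — the two-step data of `T₀T₁ + T₂⁴` (✓ `twoStepData_A₃` with `α = β = 0`, `γ = 1`, no tails);
* ★★★ `OneStep.towerLevel_two_origin_A₅` — for EVERY blow-up tower `D` (`hD0`, `hDsucc`) and every field `K`, the origin of `Spec K[y₀,y₁,y₂]/(y₀y₁ + y₂⁶)` has
  `D`-level `2`: marks `Λ 0 = Λ 1 = ∅` (graph charts, ✓ `A_charts_regular_off_origin₂`), `Λ 2 = {0}`; the translate at the mark is `T₀T₁ + T₂⁴` whose origin has
  level `1` (✓ `OneStep.twoStepAt_origin` + `hDsucc 0` + `hD0`); then ✓ `towerLevel_succ_origin_marked` with `d = 1`.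

This is the first point of intrinsic blow-up depth `2` certified in the route's currency; the same turn of the engine handles `A_{2k+1}`, `D_k`, `E_6`, `E_7`, `E_8`
recursively (polynomial data only).  Honest label: closes no registered stub.

References: [Hartshorne1977, I Thm. 5.1, I Ex. 5.6, II Ex. 7.12]; [Lipman1969, §24]; [StacksProject, Tags 0804, 080E]; through the cited tree files.
-/

set_option linter.dupNamespace false -- mandated namespace `Summit.<Summit>.<Problem>` of this single-conjunct summit

noncomputable section

open CategoryTheory CategoryTheory.Limits AlgebraicGeometry TopologicalSpace Topology
open MvPolynomial
open Literature.AlgebraicGeometry.Resolution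
open AlgebraicGeometry.Scheme.IdealSheafData

namespace Summit.ResolutionOfSingularities.ResolutionOfSingularities.Cruxes.EquisingularLiftNat.Sections

namespace SecondOrderPoint

variable (K : Type) [Field K]

/-- `y₂⁶ ∈ (y)³`. [folklore] -/
theorem A₅_tail_mem_pow : (X 2 ^ 6 : MvPolynomial (Fin 3) K) ∈ Ideal.span (Set.range (X : Fin 3 → MvPolynomial (Fin 3) K)) ^ 3 :=
  Ideal.pow_le_pow_right (by norm_num : 3 ≤ 6) (Ideal.pow_mem_pow (Ideal.subset_span (Set.mem_range_self (2 : Fin 3))) 6)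

/-- **Chart `2` of the `A₅` specimen**: `f(T₂T₀, T₂T₁, T₂) = T₂²·(T₀T₁ + T₂⁴)`. [cite: Hartshorne1977, II Ex. 7.12] -/
theorem A₅_strictTransform₂ :
    aeval (fun j => X 2 * Function.update (X : Fin 3 → MvPolynomial (Fin 3) K) 2 1 j) (X 0 * X 1 + X 2 ^ 6 : MvPolynomial (Fin 3) K) =
      X 2 ^ 2 * (X 0 * X 1 + X 2 ^ 4) := by
  rw [map_add, aeval_subst_X_mul_X_of_ne K 2 0 1 (by decide) (by decide), map_pow, aeval_X, Function.update_self]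
  ring

/-- **The two-step data of the `A₃` specimen `T₀T₁ + T₂⁴`** (✓ `twoStepData_A₃` with `α = β = 0`, `γ = 1`, `Ψ₁⁰ = Ψ₂⁰ = Ψ₅ = 0`, the expression simplified).
[cite: Hartshorne1977, I Thm. 5.1, II Ex. 7.12] -/
theorem A₃_specimen_twoStepData :
    (X 2 ^ 4 : MvPolynomial (Fin 3) K) ∈ Ideal.span (Set.range (X : Fin 3 → MvPolynomial (Fin 3) K)) ^ (2 + 1) ∧
    ∃ G : Fin 3 → MvPolynomial (Fin 3) K,
      (∀ a, aeval (fun j => X a * Function.update (X : Fin 3 → MvPolynomial (Fin 3) K) a 1 j) (X 0 * X 1 + X 2 ^ 4 : MvPolynomial (Fin 3) K) =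
        X a ^ 2 * G a) ∧
      (∀ a, ∀ P : Ideal (MvPolynomial (Fin 3) K), P.IsPrime → (X a : MvPolynomial (Fin 3) K) ∈ P → G a ∈ P →
        (∃ j, pderiv j (G a) ∉ P) ∨ ∀ i, (X i : MvPolynomial (Fin 3) K) ∈ P) ∧
      (∀ a, G a ∈ Ideal.span (Set.range (X : Fin 3 → MvPolynomial (Fin 3) K)) →
        ∃ (μ' : ℕ) (Φ' Ψ' : MvPolynomial (Fin 3) K), 1 ≤ μ' ∧ Φ'.IsHomogeneous μ' ∧ Φ' ≠ 0 ∧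
          Ψ' ∈ Ideal.span (Set.range (X : Fin 3 → MvPolynomial (Fin 3) K)) ^ (μ' + 1) ∧ G a = Φ' + Ψ' ∧
          ∀ b : Fin 3, ∃ G' : MvPolynomial (Fin 3) K,
            aeval (fun j => X b * Function.update (X : Fin 3 → MvPolynomial (Fin 3) K) b 1 j) (Φ' + Ψ') = X b ^ μ' * G' ∧
            ∀ P : Ideal (MvPolynomial (Fin 3) K), P.IsPrime → (X b : MvPolynomial (Fin 3) K) ∈ P → G' ∈ P → ∃ j, pderiv j G' ∉ P) := by
  obtain ⟨hΨ, G, hG, hjac, hsec⟩ := twoStepData_A₃ K (0 : K) 0 1 (by norm_num) (Ψ₁₀ := 0) (Ψ₂₀ := 0) (Ψ₅ := 0)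
    (isHomogeneous_zero _ _ _) (Ideal.zero_mem _) (isHomogeneous_zero _ _ _) (Ideal.zero_mem _) (Ideal.zero_mem _)
  have e : ((X 2 ^ 2 * (C (0 : K) * X 0 + C (0 : K) * X 1) + 0) + (C (1 : K) * X 2 ^ 4 + 0 + 0) : MvPolynomial (Fin 3) K) = X 2 ^ 4 := by
    simp
  rw [e] at hΨ hG
  exact ⟨hΨ, G, hG, hjac, hsec⟩

end SecondOrderPoint

namespace OneStep

variable (K : Type) [Field K]

/-- ★★★ **THE `A₅` POINT `y₀y₁ + y₂⁶` HAS LEVEL `2` IN EVERY BLOW-UP TOWER** (first depth-`2` certificate; one turn of ✓ `towerLevel_succ_origin_marked` over the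
level-`1` certificate of the `A₃` specimen). [OURS] [cite: Hartshorne1977, I Thm. 5.1, I Ex. 5.6] [cite: StacksProject, Tag 080E] -/
theorem towerLevel_two_origin_A₅ (D : ℕ → ∀ Γ : Scheme.{0}, Γ → Prop)
    (hD0 : ∀ (Γ : Scheme.{0}) (y : Γ), IsClosed (({y} : Set Γ)) →
      (D 0 Γ y ↔ ∀ (hy : IsClosed (({y} : Set Γ))) (Z : Scheme.{0}) (τ : Z ⟶ Γ), IsBlowup τ (vanishingIdeal ⟨{y}, hy⟩) →
        ∀ z : Z, τ z = y → IsRegularLocalRing (Z.presheaf.stalk z)))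
    (hDsucc : ∀ (d : ℕ) (Γ : Scheme.{0}) (y : Γ), IsClosed (({y} : Set Γ)) →
      (D (d + 1) Γ y ↔ ∀ (hy : IsClosed (({y} : Set Γ))) (Z : Scheme.{0}) (τ : Z ⟶ Γ), IsBlowup τ (vanishingIdeal ⟨{y}, hy⟩) →
        ∃ S' : Finset Z, (∀ z : Z, τ z = y → z ∉ S' → IsRegularLocalRing (Z.presheaf.stalk z)) ∧
          ∀ z ∈ S', τ z = y ∧ IsClosed (({z} : Set Z)) ∧ ∃ d' ≤ d, D d' Z z))
    (y₀ : Spec (CommRingCat.of (MvPolynomial (Fin 3) K ⧸ Ideal.span {(X 0 * X 1 + X 2 ^ 6 : MvPolynomial (Fin 3) K)})))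
    (hy₀ : y₀.asIdeal = Ideal.map (Ideal.Quotient.mk (Ideal.span {(X 0 * X 1 + X 2 ^ 6 : MvPolynomial (Fin 3) K)}))
      (Ideal.span (Set.range (X : Fin 3 → MvPolynomial (Fin 3) K)))) :
    D 2 (Spec (CommRingCat.of (MvPolynomial (Fin 3) K ⧸ Ideal.span {(X 0 * X 1 + X 2 ^ 6 : MvPolynomial (Fin 3) K)}))) y₀ := by
  classical
  have hΦ : (X 0 * X 1 : MvPolynomial (Fin 3) K).IsHomogeneous 2 := by
    simpa using (isHomogeneous_X K (0 : Fin 3)).mul (isHomogeneous_X K (1 : Fin 3))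
  have hΦ0 : (X 0 * X 1 : MvPolynomial (Fin 3) K) ≠ 0 := mul_ne_zero (X_ne_zero 0) (X_ne_zero 1)
  have hΨ6 := SecondOrderPoint.A₅_tail_mem_pow K
  -- strict transforms: graph charts `0`, `1` (regular along `E`), chart `2` explicit
  obtain ⟨⟨G₀, hG₀, hJ₀⟩, ⟨G₁, hG₁, hJ₁⟩, -⟩ := SecondOrderPoint.A_charts_regular_off_origin₂ K hΨ6
  have hG₂ := SecondOrderPoint.A₅_strictTransform₂ K
  have hG₂' : (X 0 * X 1 + X 2 ^ 4 : MvPolynomial (Fin 3) K) - X 0 * X 1 ∈ Ideal.span {(X 2 : MvPolynomial (Fin 3) K)} :=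
    Ideal.mem_span_singleton'.mpr ⟨X 2 ^ 3, by ring⟩
  -- the level-`1` certificate of the `A₃` specimen at the origin of `Spec K[T]/(T₀T₁ + T₂⁴)`
  obtain ⟨hΨ4, GA, hGA, hjacA, hsecA⟩ := SecondOrderPoint.A₃_specimen_twoStepData K
  have hlevA : ∀ y' : Spec (CommRingCat.of (MvPolynomial (Fin 3) K ⧸ Ideal.span {(X 0 * X 1 + X 2 ^ 4 : MvPolynomial (Fin 3) K)})),
      y'.asIdeal = Ideal.map (Ideal.Quotient.mk (Ideal.span {(X 0 * X 1 + X 2 ^ 4 : MvPolynomial (Fin 3) K)}))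
        (Ideal.span (Set.range (X : Fin 3 → MvPolynomial (Fin 3) K))) →
      ∃ d' ≤ 1, D d' (Spec (CommRingCat.of (MvPolynomial (Fin 3) K ⧸ Ideal.span {(X 0 * X 1 + X 2 ^ 4 : MvPolynomial (Fin 3) K)}))) y' := by
    intro y' hy'
    have hmax' := isMaximal_map_mk_span_range_X K (X 0 * X 1) (X 2 ^ 4) (by norm_num) hΦ hΨ4
    have hy'cl : IsClosed ({y'} : Set _) := (PrimeSpectrum.isClosed_singleton_iff_isMaximal y').mpr (hy' ▸ hmax')
    have h2 := twoStepAt_origin K (X 0 * X 1) (X 2 ^ 4) (by norm_num) hΦ hΦ0 hΨ4 GA hGA hjacA hsecA y' hy'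
    refine ⟨1, le_rfl, (hDsucc 0 _ y' hy'cl).mpr fun hy Z τ hτ => ?_⟩
    obtain ⟨S', hreg, hS'⟩ := h2 hy Z τ hτ
    refine ⟨S', hreg, fun z hz => ?_⟩
    obtain ⟨hτz, hzcl, hone⟩ := hS' z hz
    exact ⟨hτz, hzcl, 0, le_rfl, (hD0 Z z hzcl).mpr fun _ Z' τ' hτ' z' hz' => hone Z' τ' hτ' z' hz'⟩
  -- one turn of the marked engine, `d = 1`
  refine towerLevel_succ_origin_marked K D hD0 hDsucc 1 (X 0 * X 1) (X 2 ^ 6) (by norm_num) hΦ hΦ0 hΨ6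
    ![G₀, G₁, X 0 * X 1 + X 2 ^ 4] (fun a => ?_) ![∅, ∅, {(0 : Fin 3 → K)}] (fun a P hP haP hGP => ?_) (fun a lam hlam _ => ?_) y₀ hy₀
  · fin_cases a
    · exact hG₀
    · exact hG₁
    · exact hG₂
  · fin_cases a
    · exact Or.inl (hJ₀ P hP haP)
    · exact Or.inl (hJ₁ P hP haP)
    · by_cases hall : ∀ j, pderiv j (X 0 * X 1 + X 2 ^ 4 : MvPolynomial (Fin 3) K) ∈ P
      · right
        refine ⟨0, Finset.mem_singleton_self _, fun i => ?_⟩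
        simpa using SecondOrderPoint.forall_X_mem_of_sub_mul_mem_span₃ K hG₂' P haP (hall 0) (hall 1) i
      · left
        push Not at hall
        exact hall
  · fin_cases a
    · simp at hlam
    · simp at hlam
    · have hlam0 : lam = 0 := by simpa using hlam
      subst hlam0
      refine ⟨2, X 0 * X 1, X 2 ^ 4, by norm_num, hΦ, hΨ4, ?_, hlevA⟩
      have h0 : (fun i : Fin 3 => X i + C ((0 : Fin 3 → K) i)) = (X : Fin 3 → MvPolynomial (Fin 3) K) := by
        funext i; simp
      simp only [h0, MvPolynomial.aeval_X_left, AlgHom.coe_id, id_eq]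
      rfl

end OneStep

end Summit.ResolutionOfSingularities.ResolutionOfSingularities.Cruxes.EquisingularLiftNat.Sections

end
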